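import Literature.Analysis.FluidPDE.FluidComputer.ThresholdLevelTableA5
import HarnessLib

/-!
# Kernel run of the A = 5 level-table checker, chunks 56 … 59 (steps 1400 … 1499) (bp3 gen 13, layer 4)

HONEST FRAMING: low prior, high value-of-information experiment on Tao's machine paradigm; NOT a
claim that NS blows up.

Four kernel evaluations (`decide +kernel`; no `native_decide`, no extra axioms) of the checker
`runSteps` (`ThresholdLevelCheck.lean`) on 25 steps of `ThresholdLevelTableA5.stepsT` at a time, from
the entry box `Bc i` towards the next chunk's first level, returning the entry box `Bc (i+1)`
(≈ 30 s of kernel time per chunk; same scheme as `ThresholdLevelTableRun0 … 7` for A = 2).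
-/

namespace Literature.Analysis.FluidPDE.FluidComputer

namespace ThresholdLevelTableA5

set_option maxHeartbeats 10000000 in
set_option maxRecDepth 200000 in
/-- Chunk 56 of the A = 5 table run (steps 1400 … 1424). [folklore] -/
theorem run56 : runSteps 60 12 3 GIt RbIt Bc56 chunk56 32595161951627792 = some Bc57 := by
  decide +kernel

set_option maxHeartbeats 10000000 in
set_option maxRecDepth 200000 in
/-- Chunk 57 of the A = 5 table run (steps 1425 … 1449). [folklore] -/
theorem run57 : runSteps 60 12 3 GIt RbIt Bc57 chunk57 35679777506166664 = some Bc58 := by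
  decide +kernel

set_option maxHeartbeats 10000000 in
set_option maxRecDepth 200000 in
/-- Chunk 58 of the A = 5 table run (steps 1450 … 1474). [folklore] -/
theorem run58 : runSteps 60 12 3 GIt RbIt Bc58 chunk58 39056303042113928 = some Bc59 := by
  decide +kernel

set_option maxHeartbeats 10000000 in
set_option maxRecDepth 200000 in
/-- Chunk 59 of the A = 5 table run (steps 1475 … 1499). [folklore] -/
theorem run59 : runSteps 60 12 3 GIt RbIt Bc59 chunk59 42752363213414088 = some Bc60 := by
  decide +kernel

end ThresholdLevelTableA5

end Literature.Analysis.FluidPDE.FluidComputer
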